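import Literature.Analysis.Complex.AnalyticFormalRoots
import HarnessLib

/-!
# Principal part of a germ `Θ(s) s^{-N}` at `s = 0`

Topic `Literature/Analysis/Complex` (namespace `Literature.Analysis.Complex.PrincipalPart`).
PROVED, no definition: for `Θ` analytic at `0` and `N ∈ ℕ`, the germ `Θ(s)/s^N` (meromorphic,
pole of order `≤ N`) splits as `A(s⁻¹) + g(s)` on a punctured neighbourhood of `0`, with
`A ∈ ℂ[w]` of degree `≤ N` (the principal part together with the constant term) and `g`
analytic at `0`, `g(0) = 0` (`exists_principal_part`). This is Taylor's formula with
holomorphic remainder (`FormalRoot.exists_taylor_remainder_on_ball`). [folklore]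

## References

* R. Remmert, *Theory of Complex Functions*, GTM 122, Springer 1991, Ch. 12 §1.2 (principal
  part of a Laurent expansion). [folklore]
-/

noncomputable section

open Complex Filter Topology Set Metric Finset PowerSeries
open scoped Nat Polynomial

namespace Literature.Analysis.Complex

namespace PrincipalPart

open Literature.Analysis.Complex.FormalRoot (exists_taylor_remainder_on_ball
  analyticAt_of_differentiableOn_ball)

/-- The Taylor series of `f : ℂ → ℂ` at `0`, as a formal power series (local notation). -/
local notation3 "𝓣[" f "]" =>
  (PowerSeries.mk fun n => ((Nat.factorial n : ℂ)⁻¹ * iteratedDeriv n f 0) : PowerSeries ℂ)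

/-- An analytic germ at `0` is differentiable on some ball around `0`. [folklore] -/
theorem exists_ball_differentiableOn {Θ : ℂ → ℂ} (hΘ : AnalyticAt ℂ Θ 0) :
    ∃ r > 0, DifferentiableOn ℂ Θ (ball 0 r) := by
  obtain ⟨r, hr, h⟩ := Metric.eventually_nhds_iff_ball.1 hΘ.eventually_analyticAt
  exact ⟨r, hr, fun z hz => (h z hz).differentiableAt.differentiableWithinAt⟩

/-- **Principal part.** For `Θ` analytic at `0` and `N ∈ ℕ` there are `A ∈ ℂ[w]` with
`deg A ≤ N` and `g` analytic at `0` with `g 0 = 0` such that `Θ(s)/s^N = A(s⁻¹) + g(s)` for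
all `s ≠ 0` near `0`. [folklore] -/
theorem exists_principal_part {Θ : ℂ → ℂ} (hΘ : AnalyticAt ℂ Θ 0) (N : ℕ) :
    ∃ (A : ℂ[X]) (g : ℂ → ℂ), AnalyticAt ℂ g 0 ∧ g 0 = 0 ∧ A.natDegree ≤ N ∧
      ∀ᶠ s in 𝓝[≠] (0 : ℂ), Θ s / s ^ N = A.eval s⁻¹ + g s := by
  obtain ⟨r, hr, hdiff⟩ := exists_ball_differentiableOn hΘ
  obtain ⟨R, hR, hΘR, -⟩ := exists_taylor_remainder_on_ball hr hdiff N
  set A : ℂ[X] := Polynomial.C (R 0) +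
    ∑ k ∈ range N, Polynomial.C (coeff k 𝓣[Θ]) * Polynomial.X ^ (N - k) with hA
  refine ⟨A, fun s => R s - R 0, (analyticAt_of_differentiableOn_ball hr hR).sub analyticAt_const,
    sub_self _, ?_, ?_⟩
  · rw [hA]
    refine (Polynomial.natDegree_add_le _ _).trans (max_le (by simp) ?_)
    refine Polynomial.natDegree_sum_le_of_forall_le _ _ fun k _ => ?_
    exact (Polynomial.natDegree_C_mul_le _ _).trans
      ((Polynomial.natDegree_pow_le).trans (by simp))
  · have hball : ∀ᶠ s in 𝓝[≠] (0 : ℂ), s ∈ ball (0 : ℂ) r :=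
      eventually_nhdsWithin_of_eventually_nhds (ball_mem_nhds 0 hr)
    filter_upwards [hball, self_mem_nhdsWithin] with s hs hs0
    rw [hΘR s hs, add_div, mul_div_cancel_left₀ _ (pow_ne_zero N hs0), hA, Polynomial.eval_add,
      Polynomial.eval_C, Polynomial.eval_finsetSum, Finset.sum_div]
    have hterm : ∀ k ∈ range N, coeff k 𝓣[Θ] * s ^ k / s ^ N =
        (Polynomial.C (coeff k 𝓣[Θ]) * Polynomial.X ^ (N - k)).eval s⁻¹ := by
      intro k hk
      have hkN : k ≤ N := (Finset.mem_range.1 hk).le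
      rw [Polynomial.eval_mul, Polynomial.eval_C, Polynomial.eval_pow, Polynomial.eval_X, inv_pow,
        mul_div_assoc]
      congr 1
      rw [div_eq_iff (pow_ne_zero N hs0), ← pow_sub_mul_pow s hkN]
      field_simp
      rw [mul_div_assoc, div_self (pow_ne_zero _ hs0), mul_one]
    rw [Finset.sum_congr rfl hterm]
    ring

end PrincipalPart

end Literature.Analysis.Complex

end
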